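import Literature.AlgebraicGeometry.Frobenioids.EquivalenceUnitsTransport
import Literature.AlgebraicGeometry.Frobenioids.RigiditySlimness
import Literature.AlgebraicGeometry.Frobenioids.BaseSquareUniqueness
import HarnessLib

/-!
# Frobenioids I, Theorem 3.4 (v), first sentence: over a SLIM base an equivalence preserves
# base-equivalent pairs (and base-identity endomorphisms)

Mochizuki, *The geometry of Frobenioids I: the general theory*, Kyushu J. Math. **62** (2008)
293–400, Thm. 3.4 (v) p. 63 ll. 22–25, proof p. 67 l. 23 – p. 69 l. 20
[cite: MochizukiFrdI2008, Thm. 3.4 (v) p.63]: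

> "(v) Suppose that … (c) `D_1`, `D_2` are slim. Then `Ψ` preserves the base-identity endomorphisms
> and base-equivalent pairs of co-objective morphisms."

Sub-node FrdI:Thm3.4(v)/L12 (L12a endomorphisms + L12b pairs) of plan/L1/SUBDAG-FrdI-Thm34.md (seat
abc-iut-L1-d4 gen 2). ROUTE — the printed idea (an arrow of `D_i` is determined, `D_i` being slim, by the
functor it induces on slices, and the slices `(D_i)_{A_D}` are the pull-back slices `(P_i)_A = (C_i^{pl-bk})_A`
of Def. 1.3 (i)(c)) run as a RIGIDITY argument in the style of abc-iut-L1-t10's proof of Cor. 4.11 (i),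
WITHOUT the 2-categories `Q_i`: given parallel `φ, ψ : A → B` of `C₁` with `Base(φ) = Base(ψ)`, every
pull-back morphism `γ : Y → A` yields — by the factorisation `γ ≫ ψ = g ≫ α` of Def. 1.3 (iv)(a)
(`α` pull-back, `Base(g)` invertible) and the unique lift `ℓ` of `γ ≫ φ` along `α` with `Base(ℓ) = Base(g)`
(Def. 1.2 (ii)) — the automorphism `Base(Ψℓ) ≫ Base(Ψg)⁻¹` of `Base(ΨY)`; it is independent of the
factorisation (`LiftData.val_eq`) and natural in `γ` (`LiftData.val_natural`), hence (transported to the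
pull-back slice of `ΨA` along `Ψ⁻¹`) a natural automorphism of `(C₂^{pl-bk})_{ΨA} → D₂`, which is the
identity because that functor is rigid (`D₂` slim, Def. 1.3 (i)(c), Prop. 1.13 (i)); at `γ = id` this reads
`Base(Ψφ) = Base(Ψψ)`. Input by name: `Ψ` carries base-isomorphisms to base-isomorphisms (Thm. 3.4 (iii));
no hypothesis on `Ψ⁻¹` or on `D₁` is needed in this direction. Nothing of [FrdI] is restated.
-/

namespace Literature.AlgebraicGeometry.Frobenioids

open CategoryTheory Opposite

universe w v v' u u'

namespace PreFrobenioid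

section One

variable {D : Type u} [Category.{v} D] {Φ : Dᵒᵖ ⥤ CommMonCat.{w}} {C : Type u'} [Category.{v'} C]
  {F : C ⥤ ElemFrobenioid Φ}

/-- Unique lifting along a pull-back morphism (Def. 1.2 (ii)), in the `Base F` spelling.
[cite: MochizukiFrdI2008, Def. 1.2 (ii) p.21] -/
theorem existsUnique_lift_of_isPullbackMorphism {A B X : C} {α : A ⟶ B} (hα : IsPullbackMorphism F α)
    (χ : X ⟶ B) (β : baseObj F X ⟶ baseObj F A) (h : β ≫ Base F α = Base F χ) :
    ∃! x : X ⟶ A, x ≫ α = χ ∧ Base F x = β :=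
  (PreFrobenioidData.ofFunctor_isPullbackMorphism F α).mpr hα χ β h

/-- Two morphisms into the source of a pull-back morphism with the same composite and the same base
coincide. [cite: MochizukiFrdI2008, Def. 1.2 (ii) p.21] -/
theorem eq_of_isPullbackMorphism {A B X : C} {α : A ⟶ B} (hα : IsPullbackMorphism F α) {x y : X ⟶ A}
    (h1 : x ≫ α = y ≫ α) (h2 : Base F x = Base F y) : x = y :=
  (existsUnique_lift_of_isPullbackMorphism hα (y ≫ α) (Base F y) (by rw [base_comp])).unique
    ⟨h1, h2⟩ ⟨rfl, rfl⟩

/-- `Base` of an isomorphism is an isomorphism. [cite: MochizukiFrdI2008, Def. 1.1 p.19] -/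
theorem isIso_base_of_isIso {A B : C} (φ : A ⟶ B) [IsIso φ] : IsIso (Base F φ) :=
  ⟨Base F (inv φ), by rw [← base_comp, IsIso.hom_inv_id, base_id], by rw [← base_comp, IsIso.inv_hom_id, base_id]⟩

end One

section Two

variable {D₁ : Type u} [Category.{v} D₁] {Φ₁ : D₁ᵒᵖ ⥤ CommMonCat.{w}} {C₁ : Type u'} [Category.{v'} C₁]
  {D₂ : Type u} [Category.{v} D₂] {Φ₂ : D₂ᵒᵖ ⥤ CommMonCat.{w}} {C₂ : Type u'} [Category.{v'} C₂]
  {F₁ : C₁ ⥤ ElemFrobenioid Φ₁} {F₂ : C₂ ⥤ ElemFrobenioid Φ₂}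

variable (F₁ F₂) in
/-- The data attached to a morphism `γ : Y → A'` and a parallel pair `φ₁, ψ₁ : A' → B` (proof of Thm. 3.4
(v)): a factorisation `γ ≫ ψ₁ = g ≫ α` with `α` a pull-back morphism and `Base(g)`, `Base(Gg)` invertible,
and the lift `ℓ` of `γ ≫ φ₁` along `α` with `Base(ℓ) = Base(g)`. [cite: MochizukiFrdI2008, Thm. 3.4 (v) p.68] -/
structure LiftData (G : C₁ ⥤ C₂) {Y A' B : C₁} (φ₁ ψ₁ : A' ⟶ B) (γ : Y ⟶ A') where
  /-- the source of the pull-back morphism -/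
  P : C₁
  /-- the first factor of `γ ≫ ψ₁` -/
  g : Y ⟶ P
  /-- the pull-back factor of `γ ≫ ψ₁` -/
  α : P ⟶ B
  /-- the lift of `γ ≫ φ₁` along `α` over `Base(g)` -/
  ℓ : Y ⟶ P
  /-- `α` is a pull-back morphism -/
  hα : IsPullbackMorphism F₁ α
  /-- `Base(g)` is invertible -/
  isIso_base : IsIso (Base F₁ g)
  /-- `Base(G g)` is invertible -/
  isIso_map : IsIso (Base F₂ (G.map g))
  /-- the factorisation -/
  hg : g ≫ α = γ ≫ ψ₁
  /-- the lift -/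
  hℓ : ℓ ≫ α = γ ≫ φ₁
  /-- … over `Base(g)` -/
  hbase : Base F₁ ℓ = Base F₁ g

namespace LiftData

variable {G : C₁ ⥤ C₂} {Y A' B : C₁} {φ₁ ψ₁ : A' ⟶ B} {γ : Y ⟶ A'}

/-- The VALUE `Base(Gℓ) ≫ Base(Gg)⁻¹`, an endomorphism of `Base(GY)`. [cite: MochizukiFrdI2008, Thm. 3.4 (v) p.68] -/
noncomputable def val (d : LiftData F₁ F₂ G φ₁ ψ₁ γ) : baseObj F₂ (G.obj Y) ⟶ baseObj F₂ (G.obj Y) :=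
  haveI := d.isIso_map
  Base F₂ (G.map d.ℓ) ≫ inv (Base F₂ (G.map d.g))

/-- `val ≫ Base(Gg) = Base(Gℓ)`. [cite: MochizukiFrdI2008, Thm. 3.4 (v) p.68] -/
theorem val_comp (d : LiftData F₁ F₂ G φ₁ ψ₁ γ) : d.val ≫ Base F₂ (G.map d.g) = Base F₂ (G.map d.ℓ) := by
  haveI := d.isIso_map
  unfold val
  rw [Category.assoc, IsIso.inv_hom_id, Category.comp_id]

end LiftData

section Core

variable (hF₁ : IsFrobenioid F₁) (G : C₁ ⥤ C₂)
  (hbiso : ∀ ⦃X Y : C₁⦄ (f : X ⟶ Y), IsIso (Base F₁ f) → IsIso (Base F₂ (G.map f)))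
  {A' B : C₁} {φ₁ ψ₁ : A' ⟶ B} (hφψ : Base F₁ φ₁ = Base F₁ ψ₁)

include hF₁ hbiso hφψ in
/-- Lift data exist (Def. 1.3 (iv)(a) for `γ ≫ ψ₁`, then Def. 1.2 (ii); the compatibility of bases is
exactly `Base(φ₁) = Base(ψ₁)`). [cite: MochizukiFrdI2008, Thm. 3.4 (v) p.68] -/
theorem nonempty_liftData {Y : C₁} (γ : Y ⟶ A') : Nonempty (LiftData F₁ F₂ G φ₁ ψ₁ γ) := by
  obtain ⟨X, P, γ'', β, α, hfac, hγ'', hβ, hα⟩ := hF₁.iv_a_exists (γ ≫ ψ₁)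
  haveI : IsIso (Base F₁ γ'') := hγ''.2
  haveI : IsIso (Base F₁ β) := hβ.2
  have hgiso : IsIso (Base F₁ (γ'' ≫ β)) := by rw [base_comp]; infer_instance
  have hcompat : Base F₁ (γ'' ≫ β) ≫ Base F₁ α = Base F₁ (γ ≫ φ₁) := by
    rw [← base_comp, Category.assoc, hfac, base_comp, base_comp, hφψ]
  obtain ⟨ℓ, ⟨hℓ, hbase⟩, -⟩ := existsUnique_lift_of_isPullbackMorphism hα (γ ≫ φ₁) _ hcompat
  exact ⟨⟨P, γ'' ≫ β, α, ℓ, hα, hgiso, hbiso _ hgiso, by rw [Category.assoc, hfac], hℓ, hbase⟩⟩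

/-- **Independence of the data**: two lift data for the same `γ` have the same value (dominate one
factorisation by the other through a lift along the second pull-back morphism).
[cite: MochizukiFrdI2008, Thm. 3.4 (v) p.68] -/
theorem LiftData.val_eq {Y : C₁} {γ : Y ⟶ A'} (d d' : LiftData F₁ F₂ G φ₁ ψ₁ γ) : d.val = d'.val := by
  haveI := d.isIso_base
  haveI := d'.isIso_base
  haveI := d.isIso_map
  haveI := d'.isIso_map
  -- the comparison `z : P → P'` over `B` with `Base(z) = Base(g)⁻¹ ≫ Base(g')`
  have hcompat : (inv (Base F₁ d.g) ≫ Base F₁ d'.g) ≫ Base F₁ d'.α = Base F₁ d.α := by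
    rw [Category.assoc, ← base_comp, d'.hg, ← d.hg, base_comp, IsIso.inv_hom_id_assoc]
  obtain ⟨z, ⟨hz, hzb⟩, -⟩ := existsUnique_lift_of_isPullbackMorphism d'.hα d.α _ hcompat
  have hgz : d.g ≫ z = d'.g := eq_of_isPullbackMorphism d'.hα
    (by rw [Category.assoc, hz, d.hg, d'.hg]) (by rw [base_comp, hzb, IsIso.hom_inv_id_assoc])
  have hℓz : d.ℓ ≫ z = d'.ℓ := eq_of_isPullbackMorphism d'.hα
    (by rw [Category.assoc, hz, d.hℓ, d'.hℓ]) (by rw [base_comp, hzb, d.hbase, IsIso.hom_inv_id_assoc, d'.hbase])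
  rw [← cancel_mono (Base F₂ (G.map d'.g)), d'.val_comp, ← hℓz, ← hgz, G.map_comp, G.map_comp, base_comp,
    base_comp, ← Category.assoc, d.val_comp]

include hF₁ hbiso hφψ in
/-- **Naturality of the value** along any `m : Y → Y'`: `Base(Gm) ≫ val(γ') = val(m ≫ γ') ≫ Base(Gm)`
(factorise `m ≫ g'` once more by Def. 1.3 (iv)(a); the two lifts agree by uniqueness along `α'`).
[cite: MochizukiFrdI2008, Thm. 3.4 (v) p.68] -/
theorem LiftData.val_natural {Y Y' : C₁} {γ' : Y' ⟶ A'} {γ : Y ⟶ A'} (m : Y ⟶ Y') (hm : γ = m ≫ γ')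
    (d' : LiftData F₁ F₂ G φ₁ ψ₁ γ') (d : LiftData F₁ F₂ G φ₁ ψ₁ γ) :
    Base F₂ (G.map m) ≫ d'.val = d.val ≫ Base F₂ (G.map m) := by
  haveI := d'.isIso_base
  haveI := d'.isIso_map
  -- factorise `m ≫ g'`
  obtain ⟨X, P₂, γ'', β, α₂, hfac, hγ'', hβ, hα₂⟩ := hF₁.iv_a_exists (m ≫ d'.g)
  haveI : IsIso (Base F₁ γ'') := hγ''.2
  haveI : IsIso (Base F₁ β) := hβ.2
  have hg₂iso : IsIso (Base F₁ (γ'' ≫ β)) := by rw [base_comp]; infer_instance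
  haveI : IsIso (Base F₂ (G.map (γ'' ≫ β))) := hbiso _ hg₂iso
  -- `Base` of the two factorisations
  have hfacB : Base F₁ γ'' ≫ Base F₁ β ≫ Base F₁ α₂ = Base F₁ m ≫ Base F₁ d'.g := by
    simpa only [base_comp, Category.assoc] using congrArg (Base F₁) hfac
  have hgB : Base F₁ d'.g ≫ Base F₁ d'.α = Base F₁ γ' ≫ Base F₁ ψ₁ := by
    simpa only [base_comp] using congrArg (Base F₁) d'.hg
  -- the lift `ℓ₂` of `γ ≫ φ₁` along `α₂ ≫ α'`
  have hα₂α : IsPullbackMorphism F₁ (α₂ ≫ d'.α) := IsPullbackMorphism.comp F₁ hα₂ d'.hα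
  have hcompat : Base F₁ (γ'' ≫ β) ≫ Base F₁ (α₂ ≫ d'.α) = Base F₁ (γ ≫ φ₁) := by
    simp only [base_comp, Category.assoc, hm]
    rw [reassoc_of% hfacB, hgB, hφψ]
  obtain ⟨ℓ₂, ⟨hℓ₂, hℓ₂b⟩, -⟩ := existsUnique_lift_of_isPullbackMorphism hα₂α (γ ≫ φ₁) _ hcompat
  -- the specific data for `γ`
  have hg₂ : (γ'' ≫ β) ≫ α₂ ≫ d'.α = γ ≫ ψ₁ := by
    simp only [Category.assoc]
    rw [reassoc_of% hfac, d'.hg, hm, Category.assoc]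
  let d₂ : LiftData F₁ F₂ G φ₁ ψ₁ γ :=
    ⟨P₂, γ'' ≫ β, α₂ ≫ d'.α, ℓ₂, hα₂α, hg₂iso, hbiso _ hg₂iso, hg₂, hℓ₂, hℓ₂b⟩
  rw [LiftData.val_eq (G := G) d d₂]
  -- `ℓ₂ ≫ α₂ = m ≫ ℓ'` by uniqueness along `α'`
  have hkey : ℓ₂ ≫ α₂ = m ≫ d'.ℓ := eq_of_isPullbackMorphism d'.hα
    (by simp only [Category.assoc]; rw [hℓ₂, d'.hℓ, hm, Category.assoc])
    (by rw [base_comp, base_comp, hℓ₂b, d'.hbase, base_comp, Category.assoc, hfacB])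
  have e1 : Base F₂ (G.map m) ≫ Base F₂ (G.map d'.ℓ) = Base F₂ (G.map ℓ₂) ≫ Base F₂ (G.map α₂) := by
    rw [← base_comp, ← G.map_comp, ← hkey, G.map_comp, base_comp]
  have e2 : Base F₂ (G.map m) ≫ Base F₂ (G.map d'.g) = Base F₂ (G.map (γ'' ≫ β)) ≫ Base F₂ (G.map α₂) := by
    rw [← base_comp, ← G.map_comp, ← hfac, ← Category.assoc γ'' β α₂, G.map_comp (γ'' ≫ β) α₂, base_comp]
  have e3 : d₂.val ≫ Base F₂ (G.map (γ'' ≫ β)) = Base F₂ (G.map ℓ₂) := d₂.val_comp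
  rw [← cancel_mono (Base F₂ (G.map d'.g)), Category.assoc, d'.val_comp, Category.assoc, e1, e2,
    ← Category.assoc, e3]

end Core

/-- **[FrdI] Thm. 3.4 (v), first sentence, over a SLIM base `D₂`** (sub-node L12b): an equivalence
`Ψ : C₁ ⥲ C₂` of Frobenioids which carries base-isomorphisms to base-isomorphisms (Thm. 3.4 (iii))
PRESERVES BASE-EQUIVALENT PAIRS: `Base(φ) = Base(ψ) ⇒ Base(Ψφ) = Base(Ψψ)`.
[cite: MochizukiFrdI2008, Thm. 3.4 (v) p.63] -/
theorem baseEquivalent_map_of_isSlim (hF₁ : IsFrobenioid F₁) (hF₂ : IsFrobenioid F₂) (Ψ : C₁ ≌ C₂)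
    (hslim : IsSlim D₂)
    (hbiso : ∀ ⦃X Y : C₁⦄ (f : X ⟶ Y), IsIso (Base F₁ f) → IsIso (Base F₂ (Ψ.functor.map f)))
    {A B : C₁} {φ ψ : A ⟶ B} (h : BaseEquivalent F₁ φ ψ) :
    BaseEquivalent F₂ (Ψ.functor.map φ) (Ψ.functor.map ψ) := by
  -- move the pair to `A₁ := Ψ⁻¹ΨA`
  let e : Ψ.inverse.obj (Ψ.functor.obj A) ⟶ A := (Ψ.unitIso.app A).inv
  have hφψ : Base F₁ (e ≫ φ) = Base F₁ (e ≫ ψ) := by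
    unfold BaseEquivalent at h
    rw [base_comp, base_comp, h]
  -- choose lift data for every `γ : Y → Ψ⁻¹ΨA`
  have hD := fun {Y : C₁} (γ : Y ⟶ Ψ.inverse.obj (Ψ.functor.obj A)) =>
    nonempty_liftData hF₁ Ψ.functor hbiso hφψ γ
  -- counit, with names
  have hεty : ∀ Y : C₂, ∃ e : Ψ.functor.obj (Ψ.inverse.obj Y) ≅ Y, e = Ψ.counitIso.app Y :=
    fun Y => ⟨_, rfl⟩
  choose ε hε₀ using hεty
  have hε : ∀ {Y Y' : C₂} (g : Y ⟶ Y'), g ≫ (ε Y').inv = (ε Y).inv ≫ Ψ.functor.map (Ψ.inverse.map g) := by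
    intro Y Y' g
    rw [hε₀ Y, hε₀ Y']
    have := Ψ.counitIso.inv.naturality g
    dsimp at this
    exact this
  have hε' : ∀ {Y Y' : C₂} (g : Y ⟶ Y'),
      Ψ.functor.map (Ψ.inverse.map g) ≫ (ε Y').hom = (ε Y).hom ≫ g := by
    intro Y Y' g
    rw [hε₀ Y, hε₀ Y']
    have := Ψ.counitIso.hom.naturality g
    dsimp at this
    exact this
  -- the components: for `W = (Y, γ)` a pull-back slice object over `ΨA`, conjugate the value of the
  -- chosen data of `Ψ⁻¹γ` by the counit
  let dW : ∀ W : Over (⟨Ψ.functor.obj A⟩ : PullbackCat F₂),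
      LiftData F₁ F₂ Ψ.functor (e ≫ φ) (e ≫ ψ) (Ψ.inverse.map W.hom.hom) :=
    fun W => Classical.choice (hD (Ψ.inverse.map W.hom.hom))
  have hval_iso : ∀ W : Over (⟨Ψ.functor.obj A⟩ : PullbackCat F₂), IsIso (dW W).val := by
    intro W
    haveI := (dW W).isIso_map
    have hℓ : IsIso (Base F₁ (dW W).ℓ) := by rw [(dW W).hbase]; exact (dW W).isIso_base
    haveI := hbiso _ hℓ
    exact IsIso.comp_isIso
  let c : ∀ W : Over (⟨Ψ.functor.obj A⟩ : PullbackCat F₂), baseObj F₂ W.left.obj ⟶ baseObj F₂ W.left.obj :=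
    fun W => Base F₂ (ε W.left.obj).inv ≫ (dW W).val ≫ Base F₂ (ε W.left.obj).hom
  have hc_iso : ∀ W, IsIso (c W) := by
    intro W
    haveI := hval_iso W
    haveI : IsIso (Base F₂ (ε W.left.obj).inv) := isIso_base_of_isIso _
    haveI : IsIso (Base F₂ (ε W.left.obj).hom) := isIso_base_of_isIso _
    exact IsIso.comp_isIso
  -- the functor `(C₂^pl-bk)_{ΨA} → D₂`, `W ↦ Base(Y_W)`, and its natural automorphism
  let U : Over (⟨Ψ.functor.obj A⟩ : PullbackCat F₂) ⥤ D₂ :=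
    Over.forget _ ⋙ wideSubcategoryInclusion (pullbackMorphisms F₂) ⋙ baseFunctor F₂
  let ν : U ≅ U := NatIso.ofComponents (fun W => @asIso _ _ _ _ (c W) (hc_iso W)) (by
    intro W W' mm
    have hmty : ∃ m : W.left.obj ⟶ W'.left.obj, m = mm.left.hom := ⟨_, rfl⟩
    obtain ⟨m, hmm⟩ := hmty
    have hm : m ≫ W'.hom.hom = W.hom.hom := by
      rw [hmm]
      exact congrArg InducedWideCategory.Hom.hom (Over.w mm)
    change Base F₂ mm.left.hom ≫ c W' = c W ≫ Base F₂ mm.left.hom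
    rw [← hmm]
    have hnat := LiftData.val_natural hF₁ Ψ.functor hbiso hφψ (Ψ.inverse.map m)
      (by rw [← Functor.map_comp, hm]) (dW W') (dW W)
    change Base F₂ m ≫ Base F₂ (ε W'.left.obj).inv ≫ (dW W').val ≫ Base F₂ (ε W'.left.obj).hom =
      (Base F₂ (ε W.left.obj).inv ≫ (dW W).val ≫ Base F₂ (ε W.left.obj).hom) ≫ Base F₂ m
    have s1 : Base F₂ m ≫ Base F₂ (ε W'.left.obj).inv =
        Base F₂ (ε W.left.obj).inv ≫ Base F₂ (Ψ.functor.map (Ψ.inverse.map m)) := by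
      rw [← base_comp, hε m, base_comp]
    have s2 : Base F₂ (Ψ.functor.map (Ψ.inverse.map m)) ≫ Base F₂ (ε W'.left.obj).hom =
        Base F₂ (ε W.left.obj).hom ≫ Base F₂ m := by
      rw [← base_comp, hε' m, base_comp]
    simp only [Category.assoc]
    rw [reassoc_of% s1, reassoc_of% hnat, s2])
  -- `U` is rigid: it is `(C₂^pl-bk)_{ΨA} ⥲ D_{(ΨA)_D} → D₂` (Def. 1.3 (i)(c), `D₂` slim)
  have hU : IsRigidFunctor U := by
    let T := pullbackSliceToBase F₂ (Ψ.functor.obj A)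
    haveI : T.IsEquivalence := hF₂.i_c _
    have hT : IsRigidFunctor (T ⋙ Over.forget _) :=
      IsRigidFunctor.comp_of_isEquivalence T (hslim.isRigid_forget _)
    exact PreFrobenioidData.isRigidFunctor_congr (NatIso.ofComponents (fun _ => Iso.refl _) (by
      intro W W' mm
      simp only [Iso.refl_hom, Category.comp_id, Category.id_comp])) hT
  have hν : ν = Iso.refl U := hU ν
  -- evaluate at `W₀ = (ΨA, id)`
  let W₀ : Over (⟨Ψ.functor.obj A⟩ : PullbackCat F₂) := Over.mk (𝟙 (⟨Ψ.functor.obj A⟩ : PullbackCat F₂))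
  have hcW₀ : c W₀ = 𝟙 _ := congrArg (fun β : U ≅ U => β.hom.app W₀) hν
  have hval₀ : (dW W₀).val = 𝟙 _ := by
    have hB : Base F₂ (ε W₀.left.obj).hom ≫ Base F₂ (ε W₀.left.obj).inv = 𝟙 _ := by
      rw [← base_comp, Iso.hom_inv_id, base_id]
    calc (dW W₀).val
        = (Base F₂ (ε W₀.left.obj).hom ≫ Base F₂ (ε W₀.left.obj).inv) ≫ (dW W₀).val ≫
            (Base F₂ (ε W₀.left.obj).hom ≫ Base F₂ (ε W₀.left.obj).inv) := by
          rw [hB, Category.id_comp, Category.comp_id]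
      _ = Base F₂ (ε W₀.left.obj).hom ≫ c W₀ ≫ Base F₂ (ε W₀.left.obj).inv := by
          simp only [c, Category.assoc]
      _ = 𝟙 _ := by rw [hcW₀, Category.id_comp, hB]
  -- read off `Base(Ψ(e ≫ φ)) = Base(Ψ(e ≫ ψ))`
  have h2 : Base F₂ (Ψ.functor.map (dW W₀).ℓ) = Base F₂ (Ψ.functor.map (dW W₀).g) := by
    rw [← (dW W₀).val_comp, hval₀, Category.id_comp]
  have hid : ∀ χ : A ⟶ B, Ψ.inverse.map W₀.hom.hom ≫ e ≫ χ = e ≫ χ := fun χ => by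
    change Ψ.inverse.map (𝟙 (Ψ.functor.obj A)) ≫ _ = _
    rw [Ψ.inverse.map_id]
    exact Category.id_comp _
  have h3 : Base F₂ (Ψ.functor.map (Ψ.inverse.map W₀.hom.hom ≫ e ≫ φ)) =
      Base F₂ (Ψ.functor.map (Ψ.inverse.map W₀.hom.hom ≫ e ≫ ψ)) := by
    rw [← (dW W₀).hℓ, ← (dW W₀).hg, Functor.map_comp, Functor.map_comp, base_comp, base_comp, h2]
  rw [hid φ, hid ψ] at h3
  haveI : IsIso (Base F₂ (Ψ.functor.map e)) := hbiso e (isIso_base_of_isIso e)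
  unfold BaseEquivalent
  rw [← cancel_epi (Base F₂ (Ψ.functor.map e)), ← base_comp, ← base_comp, ← Ψ.functor.map_comp,
    ← Ψ.functor.map_comp]
  exact h3

/-- **[FrdI] Thm. 3.4 (v), first sentence, base-identity endomorphisms** (sub-node L12a; the pair
`(φ, id)`): under the same hypotheses `Ψ` carries base-identity endomorphisms to base-identity
endomorphisms. [cite: MochizukiFrdI2008, Thm. 3.4 (v) p.63] -/
theorem isBaseIdentity_map_of_preserves_baseIso (hF₁ : IsFrobenioid F₁) (hF₂ : IsFrobenioid F₂) (Ψ : C₁ ≌ C₂)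
    (hslim : IsSlim D₂)
    (hbiso : ∀ ⦃X Y : C₁⦄ (f : X ⟶ Y), IsIso (Base F₁ f) → IsIso (Base F₂ (Ψ.functor.map f)))
    {A : C₁} {φ : A ⟶ A} (h : IsBaseIdentity F₁ φ) : IsBaseIdentity F₂ (Ψ.functor.map φ) := by
  have h' : BaseEquivalent F₁ φ (𝟙 A) := by
    unfold BaseEquivalent
    rw [base_id]
    exact h
  have := baseEquivalent_map_of_isSlim hF₁ hF₂ Ψ hslim hbiso h'
  unfold BaseEquivalent at this
  unfold IsBaseIdentity
  rw [this, CategoryTheory.Functor.map_id, base_id]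

end Two

end PreFrobenioid

end Literature.AlgebraicGeometry.Frobenioids
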